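import Literature.NumberTheory.GaloisRepresentations.Corestriction
import Literature.NumberTheory.GaloisRepresentations.LocalKummerIota
import HarnessLib

/-!
# `cor : H²(Gal(F̄/E), μ_n) → H²(Γ_F, μ_n)` is injective on `p`-primary classes (`p ∤ [E:F]`)

For a non-archimedean local field `F` of characteristic `0` and a finite `E ⊆ F̄` with group
`S = Gal(F̄/E) ≤ Γ_F`:

* `natCard_two_mu_eq` — **`|H²(S, μ_n)| = n`** (it embeds in `ℤ/n`, `exists_injective_iota`, and
  contains the Kummer preimage of a Brauer class of order `n`, the generator of `Br(E_n/E)` for the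
  unramified `E_n` of degree `n`, `exists_resKer_eq_zmultiples`); `isAddCyclic_two_mu`;
* `eq_zero_of_primary_of_comp_eq_nsmul` — abstract: `f : A → B`, `g : B → A` between finite groups
  with `A ≃ B`, `f ∘ g = d`, `p ∤ d` ⇒ `f` is injective on the `p`-primary part;
* `resHEquivOfTop` — `H^q(G, M) ≃ H^q(S, M)` for a subgroup `S` containing every element;
* `eq_zero_of_cor_two_mu_eq_zero` — **`cor` is injective on `p`-primary classes of `H²(S, μ_n)`**
  when `p ∤ (Γ_F : S)` (`cor ∘ res = (Γ_F : S)`, both groups of order `n`).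

## References
* J.-P. Serre, *Galois Cohomology*, Springer, 1997, I §2.4 Prop. 9, II §5.2 (reduction to degree prime to `p`). [SerreGaloisCohomology1997]
* J.-P. Serre, *Corps locaux*, Hermann, 1968, XIII §3. [SerreLocalFields1979]
-/

noncomputable section

open CategoryTheory Function
open Field IsNonarchimedeanLocalField ValuativeRel IntermediateField

universe u

namespace Literature.NumberTheory.GaloisRepresentations

open _root_.TopRep _root_.ContRepresentation _root_.ContinuousCohomology DiscreteGaloisModule
open LocalWeilDatum

/-! ### Abstract: `f ∘ g = d`, `p ∤ d`, `|A| = |B|` ⇒ `f` injective on `p`-primary parts -/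

section Abstract

/-- **If `f ∘ g = d` with `p ∤ d` between finite abelian groups of the same structure (`A ≃ B`),
then `f` kills no nonzero `p`-primary element**: `f ∘ g` is bijective on the `p`-primary component
(Mathlib `AddCommGroup.primaryComponent`) of `B`, so `f` maps the `p`-primary component of `A` onto that
of `B`, and both have the same size. [folklore] -/
theorem eq_zero_of_primary_of_comp_eq_nsmul {A B : Type*} [AddCommGroup A] [AddCommGroup B] [Finite A]
    (e : A ≃+ B) (f : A →+ B) (g : B →+ A) {p d : ℕ} (hp : p.Prime) (hpd : ¬p ∣ d)
    (hfg : ∀ b, f (g b) = d • b) {a : A} (ha : ∃ k : ℕ, p ^ k • a = 0) (hfa : f a = 0) : a = 0 := by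
  classical
  haveI : Finite B := Finite.of_equiv A e.toEquiv
  have hfA : ∀ x ∈ AddCommGroup.primaryComponent A p, f x ∈ AddCommGroup.primaryComponent B p := fun x ⟨k, hk⟩ =>
    ⟨k, by rw [← map_nsmul, hk, map_zero]⟩
  have hgB : ∀ y ∈ AddCommGroup.primaryComponent B p, g y ∈ AddCommGroup.primaryComponent A p := fun y ⟨k, hk⟩ =>
    ⟨k, by rw [← map_nsmul, hk, map_zero]⟩
  let fp : AddCommGroup.primaryComponent A p →+ AddCommGroup.primaryComponent B p :=
    (f.comp (AddCommGroup.primaryComponent A p).subtype).codRestrict (AddCommGroup.primaryComponent B p) fun x => hfA x x.2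
  let gp : AddCommGroup.primaryComponent B p →+ AddCommGroup.primaryComponent A p :=
    (g.comp (AddCommGroup.primaryComponent B p).subtype).codRestrict (AddCommGroup.primaryComponent A p) fun y => hgB y y.2
  have hcomp : ∀ y : AddCommGroup.primaryComponent B p, fp (gp y) = d • y := fun y => Subtype.ext (hfg y)
  have htors : IsPrimaryTorsion p (AddCommGroup.primaryComponent B p) := fun y => by
    obtain ⟨k, hk⟩ := y.2
    exact ⟨k, Subtype.ext hk⟩
  have hbij : Bijective fun y : AddCommGroup.primaryComponent B p => d • y :=
    bijective_nsmul_of_isPrimaryTorsion htors ((Nat.Prime.coprime_iff_not_dvd hp).2 hpd).symm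
  have hsurj : Surjective fp := fun y => by
    obtain ⟨y', hy'⟩ := hbij.2 y
    exact ⟨gp y', (hcomp y').trans hy'⟩
  let eAB : AddCommGroup.primaryComponent A p ≃ AddCommGroup.primaryComponent B p :=
    e.toEquiv.subtypeEquiv fun x => by
      change (∃ k : ℕ, p ^ k • x = 0) ↔ ∃ k : ℕ, p ^ k • e x = 0
      exact ⟨fun ⟨k, hk⟩ => ⟨k, by rw [← map_nsmul, hk, map_zero]⟩,
        fun ⟨k, hk⟩ => ⟨k, e.injective (by rw [map_nsmul, hk, map_zero])⟩⟩
  have hinj : Injective fp := (Finite.injective_iff_surjective_of_equiv eAB).2 hsurj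
  obtain ⟨k, hk⟩ := ha
  have h0 : (⟨a, k, hk⟩ : AddCommGroup.primaryComponent A p) = 0 := hinj (Subtype.ext (by
    change f a = ((fp 0 : AddCommGroup.primaryComponent B p) : B)
    rw [map_zero, hfa]
    rfl))
  exact congrArg Subtype.val h0

end Abstract

/-! ### `H^q(G, M) ≃ H^q(S, M)` for `S = G` as a subgroup -/

section Top

variable {G : Type u} [Group G] [TopologicalSpace G] [IsTopologicalGroup G]
variable {M : Type u} [AddCommGroup M] [TopologicalSpace M] [DiscreteTopology M] (ρ : ContinuousRep G ℤ M)
variable (S : Subgroup G) (hS : ∀ g, g ∈ S)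

/-- `G → S`, `g ↦ g`, for a subgroup `S` containing every element. [folklore] -/
def toTopSubgroup : G →ₜ* S where
  toFun g := ⟨g, hS g⟩
  map_one' := rfl
  map_mul' _ _ := rfl
  continuous_toFun := continuous_induced_rng.2 continuous_id

/-- The identity `M → M` as a morphism `res (G → S) (M|_S) ⟶ M`. [folklore] -/
def toTopSubgroupMod : TopRep.res (toTopSubgroup S hS : G →* S) (ρ.restrict (subgroupIncl S)).toTopRep ⟶ ρ.toTopRep :=
  TopRep.ofHom
    { toLinearMap := LinearMap.id
      cont := continuous_id
      isIntertwining' := fun _ => rfl }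

/-- The map `H^q(S, M) → H^q(G, M)` along `g ↦ g : G → S`. [folklore] -/
abbrev unresH (q : ℕ) :
    continuousCohomology q (ρ.restrict (subgroupIncl S)).toTopRep ⟶ continuousCohomology q ρ.toTopRep :=
  ContinuousCohomology.map (toTopSubgroup S hS) (toTopSubgroupMod ρ S hS) q

/-- `unres ∘ res = id`. [folklore] -/
theorem unresH_resH (q : ℕ) (z : continuousCohomology q ρ.toTopRep) : unresH ρ S hS q (resH S ρ q z) = z := by
  rw [← map_comp_apply_of (subgroupIncl S) (toTopSubgroup S hS) (ContinuousMonoidHom.id G) (fun _ => rfl)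
    (𝟙 ((ρ.restrict (subgroupIncl S)).toTopRep)) (toTopSubgroupMod ρ S hS) (resIdHom (𝟙 ρ.toTopRep))
    (fun _ => rfl) q z]
  exact map_apply_of_id (ContinuousMonoidHom.id G) (fun _ => rfl) _ (fun _ => rfl) q z

/-- `res ∘ unres = id`. [folklore] -/
theorem resH_unresH (q : ℕ) (z : continuousCohomology q (ρ.restrict (subgroupIncl S)).toTopRep) :
    resH S ρ q (unresH ρ S hS q z) = z := by
  rw [← map_comp_apply_of (toTopSubgroup S hS) (subgroupIncl S) (ContinuousMonoidHom.id S)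
    (fun s => Subtype.ext rfl) (toTopSubgroupMod ρ S hS) (𝟙 ((ρ.restrict (subgroupIncl S)).toTopRep))
    (resIdHom (𝟙 (ρ.restrict (subgroupIncl S)).toTopRep)) (fun _ => rfl) q z]
  exact map_apply_of_id (ContinuousMonoidHom.id S) (fun _ => rfl) _ (fun _ => rfl) q z

/-- **`H^q(G, M) ≃ H^q(S, M)` when `S` contains every element of `G`** (restriction, with inverse the
map along `g ↦ g : G → S`). [folklore] -/
def resHEquivOfTop (q : ℕ) :
    continuousCohomology q ρ.toTopRep ≃+ continuousCohomology q (ρ.restrict (subgroupIncl S)).toTopRep :=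
  AddEquiv.mk ⟨resH S ρ q, unresH ρ S hS q, unresH_resH ρ S hS q, resH_unresH ρ S hS q⟩ (fun x y => map_add _ x y)

/-- `resHEquivOfTop` is `res`. [folklore] -/
@[simp] theorem resHEquivOfTop_apply (q : ℕ) (z : continuousCohomology q ρ.toTopRep) :
    resHEquivOfTop ρ S hS q z = resH S ρ q z := rfl

end Top

/-! ### `|H²(Gal(F̄/E), μ_n)| = n` -/

section Local

variable (F : Type u) [Field F] [ValuativeRel F] [TopologicalSpace F] [IsNonarchimedeanLocalField F]
  [CharZero F]
variable (E : IntermediateField F (AlgebraicClosure F)) [FiniteDimensional F E]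

attribute [local instance] compactSpace_of_isClosed_subgroup isClosed_layerN isClosed_galFixing'

/-- **`Br(E)` has a class of order exactly `n`**: the generator of `Br(E_n/E)` for the unramified
extension `E_n` of degree `n` (`exists_resKer_eq_zmultiples` in the frame `L₁ = L₀ F_{n f_E}`,
transported along `Gal(F̄/E) = layerN L₁ D`). [cite: SerreLocalFields1979, XIII §3 Prop. 7] -/
theorem exists_addOrderOf_eq_brauer (n : ℕ) [NeZero n] :
    ∃ u : continuousCohomology 2 ((units F).restrict (subgroupIncl (galFixing F E))).toTopRep,
      addOrderOf u = n := by
  classical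
  obtain ⟨L₀, hfin, hgal, hL₀⟩ := exists_finiteDimensional_isGalois_galFixing_subset (k := F)
    ((isOpen_galFixing F E).mem_nhds (galFixing F E).one_mem)
  haveI := hfin
  haveI := hgal
  have hL₀S : galFixing F L₀ ≤ galFixing F E := hL₀
  have hEL₀ : E ≤ L₀ := le_of_galFixing_le F hL₀S
  obtain ⟨m, hmdef⟩ : ∃ m : ℕ, m = n * fDeg F E := ⟨_, rfl⟩
  have hm : 0 < m := hmdef ▸ Nat.mul_pos (NeZero.pos n) (fDeg_pos F E)
  haveI := (unramifiedLevel_finite_abelian_unramified F hm).1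
  haveI := (unramifiedLevel_finite_abelian_unramified F hm).2.1
  let L₁ : IntermediateField F (AlgebraicClosure F) := L₀ ⊔ unramifiedLevel F m
  haveI : FiniteDimensional F L₁ := IntermediateField.finiteDimensional_sup L₀ _
  haveI : IsGalois F L₁ := isGalois_iff.2 ⟨inferInstance, inferInstance⟩
  have hEL₁ : E ≤ L₁ := hEL₀.trans le_sup_left
  have hmL : unramifiedLevel F m ≤ L₁ := le_sup_right
  let D : Subgroup (L₁ ≃ₐ[F] L₁) := (galFixing F E).map (resGal L₁)
  have hDE : layerN L₁ D = galFixing F E := by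
    change ((galFixing F E).map (resGal L₁)).comap (resGal L₁) = galFixing F E
    rw [Subgroup.comap_map_eq_self]
    rw [ker_resGal]
    exact galFixing_antitone F hEL₁
  have hfield : fieldOf F L₁ D = E := by
    apply eq_of_galFixing_eq F
    rw [← layerN_eq_galFixing, hDE]
  have hDL : unrLayer F L₁ D m ≤ D := unrLayer_le F L₁ D m
  have hnrm : ((unrLayer F L₁ D m).subgroupOf D).Normal := normal_unrLayer F L₁ D hm
  have hfm : fDeg F (fieldOf F L₁ D) ∣ m := ⟨n, by rw [hfield, hmdef, mul_comm]⟩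
  haveI := normal_layerN'_subgroupOf L₁ hDL hnrm
  have hdiv : m / fDeg F E = n := by rw [hmdef, Nat.mul_div_cancel _ (fDeg_pos F E)]
  have hrel : (unrLayer F L₁ D m).relIndex D = n := by
    have h1 := natCard_quot_unrLayer F L₁ D hm hmL hfm
    rw [hfield, hdiv] at h1
    rw [← index_layerN'_subgroupOf L₁ D (unrLayer F L₁ D m), Subgroup.index_eq_card]
    exact h1
  have hmK : m = (unrLayer F L₁ D m).relIndex D * fDeg F (fieldOf F L₁ D) := by
    rw [hrel, hfield, hmdef]
  obtain ⟨u, -, hord, -⟩ := exists_resKer_eq_zmultiples F hDL hnrm hm hmL hmK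
  -- transport along `layerN L₁ D = Gal(F̄/E)`
  let f₀ : continuousCohomology 2 (layerRep L₁ D).toTopRep →+
      continuousCohomology 2 ((units F).restrict (subgroupIncl (galFixing F E))).toTopRep :=
    (resSub (units F) hDE.ge 2).hom.toLinearMap.toAddMonoidHom
  have hinj : Injective f₀ := fun a b h => by
    have h' := congrArg (resSub (units F) hDE.le 2) h
    change resSub (units F) hDE.le 2 (resSub (units F) hDE.ge 2 a) =
      resSub (units F) hDE.le 2 (resSub (units F) hDE.ge 2 b) at h'
    rwa [resSub_resSub, resSub_resSub, resSub_self, resSub_self] at h'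
  refine ⟨f₀ u, ?_⟩
  rw [addOrderOf_injective f₀ hinj u, hord, hrel]

omit [ValuativeRel F] [TopologicalSpace F] [IsNonarchimedeanLocalField F] in
/-- `H²(π) = n` for the Kummer projection `π = (·)^n : K̄ˣ → K̄ˣ` (on a closed subgroup `S`). [folklore] -/
theorem cohomologyMap_kummerπ_two (S : Subgroup (absoluteGaloisGroup F)) [IsClosed (S : Set (absoluteGaloisGroup F))]
    (n : ℕ) (u : continuousCohomology 2 ((units F).restrict (subgroupIncl S)).toTopRep) :
    cohomologyMap (resModHom S (kummerπ F n)) 2 u = n • u := by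
  obtain ⟨c, rfl⟩ := twoCocycleClass_surjective _ u
  rw [cohomologyMap_twoCocycleClass]
  have hc : contTwoCocycles.pullback (ContinuousMonoidHom.id S) (resIdHom (resModHom S (kummerπ F n))) c = n • c :=
    Subtype.ext (ContinuousMap.ext fun q => by
      obtain ⟨σ, τ⟩ := q
      rw [pullback₂_id_resIdHom_apply, resModHom_hom_apply, kummerπ_hom_apply]
      change ((n : ℤ)) • c.1 (σ, τ) = (n • c).1 (σ, τ)
      rw [natCast_zsmul]
      rfl)
  rw [hc, ← twoCocycleClassₗ_apply, map_nsmul, twoCocycleClassₗ_apply]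

/-- **`|H²(Gal(F̄/E), μ_n)| = n`.** [cite: SerreLocalFields1979, XIII §3; SerreGaloisCohomology1997, II §5.2] -/
theorem natCard_two_mu_eq (n : ℕ) [NeZero n] :
    Nat.card (continuousCohomology 2 ((mu F n).restrict (subgroupIncl (galFixing F E))).toTopRep) = n := by
  obtain ⟨ι, hι⟩ := exists_injective_iota F E n
  haveI : Finite (continuousCohomology 2 ((mu F n).restrict (subgroupIncl (galFixing F E))).toTopRep) :=
    Finite.of_injective ι hι
  have hle : Nat.card (continuousCohomology 2 ((mu F n).restrict (subgroupIncl (galFixing F E))).toTopRep) ≤ n :=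
    (Nat.card_le_card_of_injective ι hι).trans_eq (Nat.card_zmod n)
  obtain ⟨u, hu⟩ := exists_addOrderOf_eq_brauer F E n
  have hπ : cohomologyMap (resModHom (galFixing F E) (kummerπ F n)) 2 u = 0 := by
    have h := addOrderOf_nsmul_eq_zero u
    rw [hu] at h
    rw [cohomologyMap_kummerπ_two]
    exact h
  obtain ⟨w, hw⟩ := ((isSES_kummer F n (NeZero.pos n)).res (galFixing F E)).exists_map_two_eq_of_map_two_eq_zero u hπ
  let f₁ : continuousCohomology 2 ((mu F n).restrict (subgroupIncl (galFixing F E))).toTopRep →+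
      continuousCohomology 2 ((units F).restrict (subgroupIncl (galFixing F E))).toTopRep :=
    (kummerTwo F (galFixing F E) n).hom.toLinearMap.toAddMonoidHom
  have hinj : Injective f₁ := fun a b h =>
    kummerTwo_injective F (galFixing F E) (NeZero.pos n) (subsingleton_one_units_galFixing E) h
  have hordw : addOrderOf w = n :=
    calc addOrderOf w = addOrderOf (f₁ w) := (addOrderOf_injective f₁ hinj w).symm
      _ = addOrderOf u := by rw [show f₁ w = u from hw]
      _ = n := hu
  have hdvd : n ∣ Nat.card (continuousCohomology 2 ((mu F n).restrict (subgroupIncl (galFixing F E))).toTopRep) := by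
    have h := addOrderOf_dvd_natCard w
    rwa [hordw] at h
  exact le_antisymm hle (Nat.le_of_dvd Nat.card_pos hdvd)

/-- `H²(Gal(F̄/E), μ_n)` is cyclic. [cite: SerreLocalFields1979, XIII §3 Cor. 3] -/
theorem isAddCyclic_two_mu (n : ℕ) [NeZero n] :
    IsAddCyclic (continuousCohomology 2 ((mu F n).restrict (subgroupIncl (galFixing F E))).toTopRep) := by
  obtain ⟨ι, hι⟩ := exists_injective_iota F E n
  exact isAddCyclic_of_injective ι hι

/-- `H²(Gal(F̄/E), μ_n)` is finite. [folklore] -/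
theorem finite_two_mu (n : ℕ) [NeZero n] :
    Finite (continuousCohomology 2 ((mu F n).restrict (subgroupIncl (galFixing F E))).toTopRep) :=
  Nat.finite_of_card_ne_zero (by rw [natCard_two_mu_eq]; exact NeZero.ne n)

/-! ### `cor` is injective on `p`-primary classes -/

omit [ValuativeRel F] [TopologicalSpace F] [IsNonarchimedeanLocalField F] in
/-- `Γ_F / Gal(F̄/E)` is finite. [folklore] -/
theorem finite_quot_galFixing : Finite (absoluteGaloisGroup F ⧸ galFixing F E) :=
  Subgroup.quotient_finite_of_isOpen _ (isOpen_galFixing F E)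

attribute [local instance] finite_quot_galFixing Fintype.ofFinite

/-- **`cor : H²(Gal(F̄/E), μ_n) → H²(Γ_F, μ_n)` kills no nonzero `p`-primary class when
`p ∤ (Γ_F : Gal(F̄/E))`**: `cor ∘ res = (Γ_F : Gal(F̄/E))` (`cor_resH`) and both groups have order
`n` (`natCard_two_mu_eq`, for `E` and for `F` through `resHEquivOfTop` and `Gal(F̄/F) = Γ_F`).
[cite: SerreGaloisCohomology1997, II §5.2 (reduction to an extension of degree prime to `p`)] -/
theorem eq_zero_of_cor_two_mu_eq_zero {p : ℕ} (hp : p.Prime) (hpd : ¬p ∣ (galFixing F E).index)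
    {n : ℕ} [NeZero n]
    (z : continuousCohomology 2 ((mu F n).restrict (subgroupIncl (galFixing F E))).toTopRep)
    (hz : ∃ k : ℕ, p ^ k • z = 0) (hcor : cor (galFixing F E) (mu F n) 2 z = 0) : z = 0 := by
  classical
  have hbot : ∀ g : absoluteGaloisGroup F, g ∈ galFixing F (⊥ : IntermediateField F (AlgebraicClosure F)) :=
    fun g => by rw [galFixing_bot]; trivial
  let eT := resHEquivOfTop (mu F n) (galFixing F (⊥ : IntermediateField F (AlgebraicClosure F))) hbot 2
  have hA := natCard_two_mu_eq F E n
  have hAc := isAddCyclic_two_mu F E n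
  haveI := finite_two_mu F E n
  haveI := isAddCyclic_two_mu F (⊥ : IntermediateField F (AlgebraicClosure F)) n
  have hB : Nat.card (continuousCohomology 2 (mu F n).toTopRep) = n :=
    (Nat.card_congr eT.toEquiv).trans (natCard_two_mu_eq F ⊥ n)
  have hBc : IsAddCyclic (continuousCohomology 2 (mu F n).toTopRep) :=
    isAddCyclic_of_injective eT.toAddMonoidHom eT.injective
  let e : continuousCohomology 2 ((mu F n).restrict (subgroupIncl (galFixing F E))).toTopRep ≃+
      continuousCohomology 2 (mu F n).toTopRep :=
    ((zmodAddCyclicAddEquiv hAc).symm.trans (ZMod.ringEquivCongr (hA.trans hB.symm)).toAddEquiv).trans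
      (zmodAddCyclicAddEquiv hBc)
  exact eq_zero_of_primary_of_comp_eq_nsmul e (cor (galFixing F E) (mu F n) 2).hom.toLinearMap.toAddMonoidHom
    (resH (galFixing F E) (mu F n) 2).hom.toLinearMap.toAddMonoidHom hp hpd
    (fun b => cor_resH (galFixing F E) (mu F n) 1 b) hz hcor

end Local

end Literature.NumberTheory.GaloisRepresentations

end
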